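import Literature.AnabelianGeometry.SemiGraphs.BTempQDPairGaloisDomination
import Literature.AnabelianGeometry.SemiGraphs.TemperedVerticialInjective
import HarnessLib

/-!
# Semi-graphs of anabelioids, Appendix, proof of Theorem A.4: `q_i : D_i → T_i` is essentially
# surjective — every object of `T = B^temp(Π)` is the quotient `B/Γ_B` of a QD-pair OF `Q = T[A]`

Mochizuki, *Semi-graphs of anabelioids*, Publ. RIMS **42** (2006) 221–322, Appendix, proof of
Theorem A.4, manuscript p. 83 (PRIMS p. 313 ll. 2–3) [cite: MochizukiSemiAnbd2006, Thm A.4 proof p.83]: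
"one verifies immediately that this functor `q_i` [`: D_i → T_i`, `(B, Γ_B) ↦ B/Γ_B`, `D_i` the
category of QD-pairs of `Q_i = T_i[A_i]`] is essentially surjective".

Row **A4-q′ (general case)** of `plan/L3/SUBDAG-SemiAnbd-Cor311.md` (holder abc-iut-w5-d129).
`BTempQDPairGaloisDomination.lean` did the connected case (`X` connected is `(Π/N)/(Stab(x₀)/N)`
for an open normal `N ≤ Stab(x₀) ∩ K`); here the general case, in print's scope, for the model
temperoid `B^temp(Π)` (`Π` tempered) and `T[A] = B^temp(Π)[Π/K]` (`K` open):

* §1 `BTemp.sigmaObj B` — the EXPLICIT countable coproduct `⊔_j B_j` (points `Σ j, B_j`,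
  summand-wise action; §0 "of countably connected type", Def. 3.1 (iii) p. 33) with `sigmaIncl`,
  `sigmaDesc` (copairing) and the componentwise automorphisms `sigmaAut : (∀ j, Aut B_j) →* Aut (⊔ B_j)`;
* §2 **`QDPair.exists_rel_orbitQuotient_iso`**: for EVERY object `X` of `B^temp(Π)` there is a QD-pair
  `(B, Γ)` of `B^temp(Π)` with `B` ADMITTING AN ARROW TO `Π/K` (so `(B, Γ)` is a QD-pair of `T[A]`)
  and `B/Γ ≅ X`: index the `Π`-orbits `j` of `X`, pick `x_j ∈ j` and an open normal
  `N_j ≤ Stab(x_j) ∩ K` (`Π` tempered), `B := ⊔_j Π/N_j`, `Γ := ∏_j (translations by Stab(x_j))`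
  acting summand-wise, and `B → X`, `(j, gN_j) ↦ g·x_j`, FORMS A QUOTIENT (criterion
  `QDPair.isQuotient_iff_surjective`, fibres from the connected case
  `GaloisDomination.isQuotient_orbitMap` summand by summand); and the `T[A]`-packaged form
  **`QDPair.exists_bTempRel_orbitQuotient_iso'`** (`P : QDPair (BTempRel Π K)`).

Elementary `Π`-set theory; nothing refers to the IUT corpus; no side is taken on any disputed claim.
-/

open CategoryTheory Topology

namespace Literature.AnabelianGeometry.SemiGraphs

open Literature.AlgebraicGeometry.Frobenioids (IsConnectedObj)
open Literature.AlgebraicGeometry.Frobenioids.QuasiTemperoid (BTempRel cosetAction admitsHomToCoset)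
open Literature.AlgebraicGeometry.Frobenioids.QuasiTemperoid.BTempConnected (hom_ρ hom_ext_apply
  ρ_one_apply ρ_mul_apply ρ_inv_apply hom_eq_of_apply_eq)
open GaloisObjects

universe u

/-! ### §1 Explicit countable coproducts in `B^temp(Π)` and componentwise automorphisms -/

namespace BTemp

variable {G : Type u} [Group G] [TopologicalSpace G] {J : Type u} [Countable J] (B : J → BTemp G)

/-- **The countable coproduct `⊔_j B_j` as an explicit object of `B^temp(Π)`**: points `Σ j, B_j`,
summand-wise action (countable; the stabiliser of `⟨j, y⟩` is that of `y`, hence open).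
[cite: MochizukiSemiAnbd2006, Def 3.1(iii) p.33] -/
def sigmaObj : BTemp G :=
  ⟨{ V := Σ j, (B j).obj.V
     ρ := { toFun := fun a => TypeCat.ofHom fun p => ⟨p.1, (B p.1).obj.ρ a p.2⟩
            map_one' := by
              refine ConcreteCategory.hom_ext _ _ fun p => ?_
              change (⟨p.1, (B p.1).obj.ρ 1 p.2⟩ : Σ j, (B j).obj.V) = p
              rw [ρ_one_apply]
            map_mul' := fun a b => by
              refine ConcreteCategory.hom_ext _ _ fun p => ?_
              change (⟨p.1, (B p.1).obj.ρ (a * b) p.2⟩ : Σ j, (B j).obj.V) =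
                ⟨p.1, (B p.1).obj.ρ a ((B p.1).obj.ρ b p.2)⟩
              rw [ρ_mul_apply] } }, by
    haveI : ∀ j, Countable (B j).obj.V := fun j => (B j).property.1
    refine ⟨instCountableSigma, fun p => ?_⟩
    have : {a : G | (TypeCat.ofHom fun q : Σ j, (B j).obj.V =>
          (⟨q.1, (B q.1).obj.ρ a q.2⟩ : Σ j, (B j).obj.V)) p = p}
        = {a : G | (B p.1).obj.ρ a p.2 = p.2} := by
      ext a
      simp only [Set.mem_setOf_eq, TypeCat.ofHom_apply]
      constructor
      · intro h
        exact eq_of_heq (Sigma.mk.inj_iff.mp h).2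
      · intro h
        rw [h]
    exact this ▸ (B p.1).property.2 p.2⟩

/-- The action on the coproduct, on points. [cite: MochizukiSemiAnbd2006, Def 3.1(iii) p.33] -/
@[simp] theorem sigmaObj_ρ (a : G) (p : (sigmaObj B).obj.V) :
    (sigmaObj B).obj.ρ a p = ⟨p.1, (B p.1).obj.ρ a p.2⟩ := rfl

/-- The inclusion of a summand. [cite: MochizukiSemiAnbd2006, Def 3.1(iii) p.33] -/
def sigmaIncl (j : J) : B j ⟶ sigmaObj B :=
  ObjectProperty.homMk { hom := TypeCat.ofHom fun y => ⟨j, y⟩, comm := fun _ => rfl }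

/-- The inclusion on points. [cite: MochizukiSemiAnbd2006, Def 3.1(iii) p.33] -/
@[simp] theorem sigmaIncl_apply (j : J) (y : (B j).obj.V) :
    ((sigmaIncl B j).hom.hom y : (sigmaObj B).obj.V) = ⟨j, y⟩ := rfl

variable {B}

/-- **Copairing**: a family of arrows `B_j → X` induces `⊔_j B_j → X`. [cite: MochizukiSemiAnbd2006, Def 3.1(iii) p.33] -/
def sigmaDesc {X : BTemp G} (f : ∀ j, B j ⟶ X) : sigmaObj B ⟶ X :=
  ObjectProperty.homMk
    { hom := TypeCat.ofHom fun p => (f p.1).hom.hom p.2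
      comm := fun a => by
        refine ConcreteCategory.hom_ext _ _ fun p => ?_
        exact hom_ρ (f p.1) a p.2 }

/-- Copairing on points. [cite: MochizukiSemiAnbd2006, Def 3.1(iii) p.33] -/
@[simp] theorem sigmaDesc_apply {X : BTemp G} (f : ∀ j, B j ⟶ X) (p : (sigmaObj B).obj.V) :
    ((sigmaDesc f).hom.hom p : X.obj.V) = (f p.1).hom.hom p.2 := rfl

/-- Copairing restricted to a summand. [cite: MochizukiSemiAnbd2006, Def 3.1(iii) p.33] -/
theorem sigmaIncl_desc {X : BTemp G} (f : ∀ j, B j ⟶ X) (j : J) :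
    sigmaIncl B j ≫ sigmaDesc f = f j :=
  hom_ext_apply fun _ => rfl

/-- An arrow out of the coproduct is determined by its restrictions to the summands.
[cite: MochizukiSemiAnbd2006, Def 3.1(iii) p.33] -/
theorem sigma_hom_ext {X : BTemp G} {u v : sigmaObj B ⟶ X}
    (h : ∀ j, sigmaIncl B j ≫ u = sigmaIncl B j ≫ v) : u = v :=
  hom_ext_apply fun p =>
    congrArg (fun φ : B p.1 ⟶ X => (φ.hom.hom p.2 : X.obj.V)) (h p.1)

variable (B)

/-- **Componentwise automorphisms** `(τ_j)_j ↦ ⊔_j τ_j` of the coproduct, as a group homomorphism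
(automorphisms acting summand by summand). [cite: MochizukiSemiAnbd2006, Thm A.4 proof p.84] -/
def sigmaAut : (∀ j, Aut (B j)) →* Aut (sigmaObj B) where
  toFun τ := BTemp.isoOfEquiv
    { toFun := fun p => ⟨p.1, (τ p.1).hom.hom.hom p.2⟩
      invFun := fun p => ⟨p.1, (τ p.1).inv.hom.hom p.2⟩
      left_inv := fun p => by
        change (⟨p.1, ((τ p.1).hom ≫ (τ p.1).inv).hom.hom p.2⟩ : Σ j, (B j).obj.V) = p
        rw [(τ p.1).hom_inv_id]; rfl
      right_inv := fun p => by
        change (⟨p.1, ((τ p.1).inv ≫ (τ p.1).hom).hom.hom p.2⟩ : Σ j, (B j).obj.V) = p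
        rw [(τ p.1).inv_hom_id]; rfl }
    fun a p => by
      change (⟨p.1, (τ p.1).hom.hom.hom ((B p.1).obj.ρ a p.2)⟩ : Σ j, (B j).obj.V) =
        ⟨p.1, (B p.1).obj.ρ a ((τ p.1).hom.hom.hom p.2)⟩
      rw [hom_ρ]
  map_one' := Iso.ext (hom_ext_apply fun _ => rfl)
  map_mul' _ _ := Iso.ext (hom_ext_apply fun _ => rfl)

/-- Componentwise automorphisms on points. [cite: MochizukiSemiAnbd2006, Thm A.4 proof p.84] -/
@[simp] theorem sigmaAut_apply (τ : ∀ j, Aut (B j)) (p : (sigmaObj B).obj.V) :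
    ((sigmaAut B τ).hom.hom.hom p : (sigmaObj B).obj.V) = ⟨p.1, (τ p.1).hom.hom.hom p.2⟩ := rfl

/-- A componentwise automorphism each of whose components fixes `f_j` fixes the copairing.
[cite: MochizukiSemiAnbd2006, Thm A.4 proof p.84] -/
theorem sigmaAut_comp_desc {X : BTemp G} (f : ∀ j, B j ⟶ X) (τ : ∀ j, Aut (B j))
    (h : ∀ j, (τ j).hom ≫ f j = f j) : (sigmaAut B τ).hom ≫ sigmaDesc f = sigmaDesc f :=
  hom_ext_apply fun p => congrArg (fun φ : B p.1 ⟶ X => (φ.hom.hom p.2 : X.obj.V)) (h p.1)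

end BTemp

/-! ### §2 Every object of `B^temp(Π)` is `B/Γ` for a QD-pair `(B, Γ)` of `T[A]` -/

namespace QDPair

variable {G : Type u} [Group G] [TopologicalSpace G] [IsTopologicalGroup G]

/-- In `Π/N` (`N` open normal), if `g⁻¹ g′ ∈ H` then some translation by an element of `H` carries
`gN` to `g′N` (the fibre computation of the connected case). [cite: MochizukiSemiAnbd2006, Thm A.4 proof p.83] -/
theorem GaloisDomination.exists_translation_apply_eq (hG : IsTempered G) (N : Subgroup G) [N.Normal]
    (hN : IsOpen (N : Set G)) (H : Subgroup G) {g g' : G} (h : g⁻¹ * g' ∈ H) :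
    ∃ τ ∈ GaloisDomination.translationGroup hG N hN H,
      (τ.hom.hom.hom (g : G ⧸ N) : G ⧸ N) = (g' : G ⧸ N) := by
  obtain ⟨τ, hτ⟩ := exists_aut_quotientObj hG N hN (g⁻¹ * g')
  refine ⟨τ, ⟨g⁻¹ * g', h, hτ⟩, ?_⟩
  rw [← quotientObj_ρ_one hG N hN g, hom_ρ, hτ, quotientObj_ρ_mk, mul_inv_cancel_left]

/-- A translation by an element of `H` followed by an arrow `Π/N → X` taking `N` to an `H`-fixed
point is that arrow. [cite: MochizukiSemiAnbd2006, Thm A.4 proof p.83] -/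
theorem GaloisDomination.translation_comp_eq (hG : IsTempered G) (N : Subgroup G)
    (hN : IsOpen (N : Set G)) (H : Subgroup G) {X : BTemp G} (φ : BTemp.quotientObj G hG N hN ⟶ X)
    (hH : ∀ k ∈ H, X.obj.ρ k (φ.hom.hom ((1 : G) : G ⧸ N)) = φ.hom.hom ((1 : G) : G ⧸ N))
    {τ : Aut (BTemp.quotientObj G hG N hN)} (hτ : τ ∈ GaloisDomination.translationGroup hG N hN H) :
    τ.hom ≫ φ = φ := by
  obtain ⟨k, hk, hτk⟩ := hτ
  refine hom_eq_of_apply_eq (isConnectedObj_quotientObj hG N hN) _ _ ((1 : G) : G ⧸ N) ?_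
  change (φ.hom.hom (τ.hom.hom.hom ((1 : G) : G ⧸ N)) : X.obj.V) = φ.hom.hom ((1 : G) : G ⧸ N)
  have h1 : (φ.hom.hom (τ.hom.hom.hom ((1 : G) : G ⧸ N)) : X.obj.V) = φ.hom.hom ((k : G) : G ⧸ N) :=
    congrArg (fun z => (φ.hom.hom z : X.obj.V)) hτk
  rw [h1, ← quotientObj_ρ_one hG N hN k, hom_ρ]
  exact hH k hk

/-- **"`q_i : D_i → T_i` is essentially surjective"** for `T = B^temp(Π)`, `Π` tempered, `A = Π/K`
(`K` open): every object `X` (connected or not) is `≅ B/Γ` for a QD-pair `(B, Γ)` of `B^temp(Π)`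
whose object `B` ADMITS AN ARROW TO `Π/K`, i.e. a QD-pair of `T[A] = B^temp(Π)[Π/K]` — namely
`B = ⊔_j Π/N_j` over the `Π`-orbits `j` of `X` (`N_j ≤ Stab(x_j) ∩ K` open normal, `x_j ∈ j`) and
`Γ = ∏_j (translations by Stab(x_j))` acting summand-wise. [cite: MochizukiSemiAnbd2006, Thm A.4 proof p.83] -/
theorem exists_rel_orbitQuotient_iso (hG : IsTempered G) {K : Subgroup G} (hK : IsOpen (K : Set G))
    (X : BTemp G) :
    ∃ P : QDPair (BTemp G), admitsHomToCoset G K P.A ∧ Nonempty (P.orbitQuotient ≅ X) := by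
  classical
  letI : MulAction G X.obj.V := Action.instMulAction X.obj
  haveI : Countable X.obj.V := X.property.1
  -- the (countable) set of `Π`-orbits of `X` and chosen base points
  let J : Type u := MulAction.orbitRel.Quotient G X.obj.V
  haveI : Countable J := Quotient.countable
  let x : J → X.obj.V := fun j => Quotient.out j
  have hxj : ∀ j : J, (Quotient.mk (MulAction.orbitRel G X.obj.V) (x j) : J) = j := fun j =>
    Quotient.out_eq j
  -- stabilisers and open normal subgroups `N_j ≤ Stab(x_j) ∩ K`
  let H : J → Subgroup G := fun j => MulAction.stabilizer G (x j)
  have hHmem : ∀ j (k : G), k ∈ H j ↔ X.obj.ρ k (x j) = x j := fun j k =>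
    MulAction.mem_stabilizer_iff
  have hU : ∀ j, ((H j ⊓ K : Subgroup G) : Set G) ∈ 𝓝 (1 : G) := fun j =>
    ((X.property.2 (x j)).inter hK).mem_nhds ⟨(H j).one_mem, K.one_mem⟩
  let N : J → OpenNormalSubgroup G := fun j => (hG.basis _ (hU j)).choose
  have hNU : ∀ j, ((N j : OpenNormalSubgroup G) : Set G) ⊆ ((H j ⊓ K : Subgroup G) : Set G) :=
    fun j => (hG.basis _ (hU j)).choose_spec.2
  haveI : ∀ j, (N j).toSubgroup.Normal := fun j => (N j).isNormal'
  have hNH : ∀ j (k : G), k ∈ (N j).toSubgroup → k ∈ H j := fun j k hk => (hNU j hk).1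
  have hNK : ∀ j (k : G), k ∈ (N j).toSubgroup → k ∈ K := fun j k hk => (hNU j hk).2
  -- the summands `Π/N_j`, their orbit maps `Π/N_j → X`, `N_j ↦ x_j`, and arrows `Π/N_j → Π/K`
  let B : J → BTemp G := fun j => BTemp.quotientObj G hG (N j).toSubgroup (N j).isOpen'
  have hφ : ∀ j, ∃ φ : B j ⟶ X, (φ.hom.hom ((1 : G) : G ⧸ (N j).toSubgroup) : X.obj.V) = x j :=
    fun j => exists_hom_quotientObj hG (N j).toSubgroup (N j).isOpen' (X := X) (x j)
      (fun k hk => (hHmem j k).mp (hNH j k hk))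
  let φ : ∀ j, B j ⟶ X := fun j => (hφ j).choose
  have hφ1 : ∀ j, ((φ j).hom.hom ((1 : G) : G ⧸ (N j).toSubgroup) : X.obj.V) = x j := fun j =>
    (hφ j).choose_spec
  have hφg : ∀ j (g : G), ((φ j).hom.hom (g : G ⧸ (N j).toSubgroup) : X.obj.V) = X.obj.ρ g (x j) :=
    fun j g => by rw [← quotientObj_ρ_one hG (N j).toSubgroup (N j).isOpen' g, hom_ρ, hφ1]
  have hβ : ∀ j, ∃ β : B j ⟶
      Literature.AlgebraicGeometry.Frobenioids.QuasiTemperoid.cosetObj G hG K hK,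
      (β.hom.hom ((1 : G) : G ⧸ (N j).toSubgroup) : G ⧸ K) = ((1 : G) : G ⧸ K) := fun j =>
    exists_hom_quotientObj hG (N j).toSubgroup (N j).isOpen'
      (X := Literature.AlgebraicGeometry.Frobenioids.QuasiTemperoid.cosetObj G hG K hK)
      ((1 : G) : G ⧸ K) (fun k hk => by
        change k • ((1 : G) : G ⧸ K) = ((1 : G) : G ⧸ K)
        rw [MulAction.Quotient.smul_mk, smul_eq_mul, mul_one, QuotientGroup.eq, mul_one]
        exact K.inv_mem (hNK j k hk))
  -- the QD-pair `(⊔_j Π/N_j, ∏_j translations by Stab(x_j))` and its arrow to `X`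
  let T : ∀ j, Subgroup (Aut (B j)) := fun j =>
    GaloisDomination.translationGroup hG (N j).toSubgroup (N j).isOpen' (H j)
  let P : QDPair (BTemp G) :=
    ⟨BTemp.sigmaObj B, (Subgroup.pi Set.univ T).map (BTemp.sigmaAut B)⟩
  let Φ : P.A ⟶ X := BTemp.sigmaDesc φ
  have hΦ : ∀ (j : J) (q : (B j).obj.V),
      (Φ.hom.hom (⟨j, q⟩ : (BTemp.sigmaObj B).obj.V) : X.obj.V) = (φ j).hom.hom q := fun _ _ => rfl
  have hquot : P.IsQuotient Φ := by
    refine (P.isQuotient_iff_surjective Φ).mpr ⟨?_, ?_, ?_⟩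
    · -- (a) invariance under `Γ`
      rintro δ ⟨τ, hτ, rfl⟩
      refine BTemp.sigmaAut_comp_desc B φ τ fun j => ?_
      refine GaloisDomination.translation_comp_eq hG (N j).toSubgroup (N j).isOpen' (H j) (φ j)
        (fun k hk => ?_) ((Subgroup.mem_pi _).mp hτ j (Set.mem_univ j))
      rw [hφ1]
      exact (hHmem j k).mp hk
    · -- surjective on points: `y = g⁻¹ · x_j` for `j` the orbit of `y`
      intro y
      let j : J := Quotient.mk (MulAction.orbitRel G X.obj.V) y
      have hrel : MulAction.orbitRel G X.obj.V (x j) y := Quotient.exact ((hxj j).trans rfl)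
      obtain ⟨g, hg⟩ := MulAction.orbitRel_apply.mp hrel
      refine ⟨⟨j, ((g⁻¹ : G) : G ⧸ (N j).toSubgroup)⟩, ?_⟩
      change (Φ.hom.hom (⟨j, ((g⁻¹ : G) : G ⧸ (N j).toSubgroup)⟩ : (BTemp.sigmaObj B).obj.V) :
        X.obj.V) = y
      rw [hΦ, hφg, ← hg]
      exact ρ_inv_apply X g y
    · -- fibres are `Γ`-orbits
      rintro ⟨j, q⟩ ⟨j', q'⟩ hqq'
      change (Φ.hom.hom (⟨j, q⟩ : (BTemp.sigmaObj B).obj.V) : X.obj.V) =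
        Φ.hom.hom (⟨j', q'⟩ : (BTemp.sigmaObj B).obj.V) at hqq'
      rw [hΦ, hΦ] at hqq'
      obtain ⟨g, rfl⟩ := QuotientGroup.mk_surjective q
      obtain ⟨g', rfl⟩ := QuotientGroup.mk_surjective q'
      rw [hφg, hφg] at hqq'
      -- `x_j` and `x_{j'}` lie in one orbit, so `j = j'`
      have hjj' : j = j' := by
        rw [← hxj j, ← hxj j']
        refine Quotient.sound (MulAction.orbitRel_apply.mpr ⟨g⁻¹ * g', ?_⟩)
        change X.obj.ρ (g⁻¹ * g') (x j') = x j
        rw [ρ_mul_apply, ← hqq', ρ_inv_apply]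
      subst hjj'
      -- `g⁻¹ g' ∈ Stab(x_j)` is a translation of the summand `j`
      have hh : g⁻¹ * g' ∈ H j := by
        rw [hHmem, ρ_mul_apply, ← hqq', ρ_inv_apply]
      obtain ⟨τj, hτj, hτjg⟩ := GaloisDomination.exists_translation_apply_eq hG (N j).toSubgroup
        (N j).isOpen' (H j) hh
      refine ⟨BTemp.sigmaAut B (Pi.mulSingle j τj), ⟨Pi.mulSingle j τj, ?_, rfl⟩, ?_⟩
      · refine (Subgroup.mem_pi _).mpr fun i _ => ?_
        by_cases hij : i = j
        · subst hij
          rw [Pi.mulSingle_eq_same]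
          exact hτj
        · rw [Pi.mulSingle_eq_of_ne hij]
          exact (T i).one_mem
      · change (⟨j, (Pi.mulSingle (M := fun i => Aut (B i)) j τj j).hom.hom.hom
            (g : G ⧸ (N j).toSubgroup)⟩ : (BTemp.sigmaObj B).obj.V) =
          ⟨j, (g' : G ⧸ (N j).toSubgroup)⟩
        rw [Pi.mulSingle_eq_same, hτjg]
  obtain ⟨e, -, -⟩ := hquot.existsUnique_iso_orbitQuotient
  exact ⟨P, ⟨(BTemp.sigmaDesc fun j => (hβ j).choose).hom⟩, ⟨e⟩⟩

/-- The same packaged as a QD-pair of `T[A] = BTempRel Π K` whose underlying QD-pair of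
`B^temp(Π)` (`QDPair.toBTemp`) has orbit space `≅ X`: **the functor `q : D → T` of the proof of
Theorem A.4 is essentially surjective** (model case). [cite: MochizukiSemiAnbd2006, Thm A.4 proof p.83] -/
theorem exists_bTempRel_orbitQuotient_iso' (hG : IsTempered G) {K : Subgroup G}
    (hK : IsOpen (K : Set G)) (X : BTemp G) :
    ∃ P : QDPair (BTempRel G K), Nonempty (P.toBTemp.orbitQuotient ≅ X) := by
  obtain ⟨P, hPA, ⟨e⟩⟩ := exists_rel_orbitQuotient_iso hG hK X
  let A' : BTempRel G K := ⟨P.A, hPA⟩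
  let ι : Aut A' →* Aut P.A := Functor.mapAut A' (admitsHomToCoset G K).ι
  refine ⟨⟨A', P.Γ.comap ι⟩, ?_⟩
  have hsurj : Function.Surjective ι := fun γ =>
    ⟨(admitsHomToCoset G K).fullyFaithfulι.preimageIso γ, by
      ext; rfl⟩
  have hΓ : (P.Γ.comap ι).map ι = P.Γ := Subgroup.map_comap_eq_self_of_surjective hsurj _
  have hto : (⟨A', P.Γ.comap ι⟩ : QDPair (BTempRel G K)).toBTemp = P := by
    change (⟨P.A, (P.Γ.comap ι).map ι⟩ : QDPair (BTemp G)) = P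
    rw [hΓ]
  rw [hto]
  exact ⟨e⟩

end QDPair

end Literature.AnabelianGeometry.SemiGraphs
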